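import Summits.QuantumFields.YangMills.Theorems.AlphaInputsT3ACv3EMLSecondOrder
import Literature.MathematicalPhysics.QuantumFieldTheory.Balaban1983to89.BlockAveragingEMLLinearisedBackground
import HarnessLib

/-!
# `AlphaInputsT3ACv3EMLSecondOrderMain` — STRATEGY B for 2′, NON-ABELIAN (FL) input (B2), THE MAIN TERM IDENTIFIED: the first-order bracket of
# `…v3EMLSecondOrder.norm_mlog_avgFun_sub_second_order_le` IS the tree's linearised (0.4) average `linAvg`, so
# `log Ū(c) = (Q₁Y)(c) + B₂(Y)(c) + O((ℓδ)³)` with `B₂(Y)(c) = ½(|I|⁻¹Σᵢ pairBr(Γᵢ) + pairBr(Λ) + [(Q₁Y)(c), Y(Λ)])` — lane `pub-balaban3d` ∕ cell `ym3-torus`,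
# seat `ym-ust-19936-w1` (g0)

WHY (HOME `ym-ust-19936-w1/NONABELIAN-FL-ARCH-w1-g0.md` §8).  The second-order candidates of the level-by-level exact lift are built from the LINEAR family
`X_{s+1} = Q₁X_s` (w2's tensor lifts are right inverses of the linearised average) plus the smooth quadratic corrector made of `B₂`; so (B2) must be stated with
the tree's `Q₁ = BlockAveragingEMLLinearised.linAvg` as its first-order term.  THIS FILE: §1 `holAt_one` (the trivial field transports trivially),
`walkSum_loop_add_axial` — at the flat background the tree's four-segment split `BlockAveragingEMLLinearisedBackground.covWalkSum_loop_eq` reads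
`Y(Γᵢ) + Y(Λ) = Y(Γ^σ) + Y([x,x′]) − Y(Γ^{σ′})` — and `mean_walkSum_loop_add_axial_eq_linAvg`: `|I|⁻¹Σᵢ Y(Γᵢ) + Y(Λ) = (Q₁Y)(c)` (`linAvg_def`);
§2 ★★ `norm_mlog_avgFun_sub_linAvg_sub_second_order_le`: `‖log Ū(c) − [(Q₁Y)(c) + ½(|I|⁻¹Σᵢ pairBr(Γᵢ) + pairBr(Λ) + [(Q₁Y)(c), Y(Λ)])]‖ ≤ 300000·(ℓδ)³`
(`[Q₁Y − Y(Λ), Y(Λ)] = [Q₁Y, Y(Λ)]`).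
HONEST FRAMING.  Kernel bookkeeping; nothing of [Balaban1985Averaging] asserted beyond what is proved.  Count-neutral helper toward R3 2′ (items 19936∕19935∕20520);
registry untouched; (FL) NOT proved here; nothing about d = 4, the continuum, or a mass gap; YM₃ on T³ is rung R3, not Clay.

References: T. Bałaban, Commun. Math. Phys. 98 (1985) 17–51 [Balaban1985Averaging] (Prop. 3 (121)–(125) p.36); CMP 109 (1987) 249–301 [Balaban1987RG1] ((0.4) p.253).
-/

set_option autoImplicit false

noncomputable section

open scoped Matrix.Norms.L2Operator
open NormedSpace

namespace Summit.QuantumFields.YangMills.Theorems.EMLSecondOrder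

open Literature.MathematicalPhysics.QuantumFieldTheory.Balaban1983to89
open T4Continuum BlockAveraging AveragingRT MatrixLog
open ExpMeanLog (deltaSU expMeanLogSU)
open BlockAveragingEMLLinearised (walkSum linAvg linAvg_def)
open BlockAveragingEMLLinearisedBackground (covWalkSum covWalkSum_one covWalkSum_loop_eq)
open Literature.Analysis.Calculus.BCH (pairBr)

variable {P : Params} {j : ℕ}

/-! ## §1 The loop sums plus the axial sum are the three-segment sums of `linAvg` -/

/-- The trivial configuration transports trivially along every sequence of steps. [folklore] -/
theorem holAt_one {G : Type*} [GaugeGroup G] : ∀ γ : List (LStep P j), holAt (1 : GaugeField P j G) γ = 1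
  | [] => holAt_nil _
  | s :: γ => by
    rw [holAt_cons, holAt_one γ, mul_one]
    cases s.fwd <;> simp [show (1 : GaugeField P j G) s.bond = 1 from rfl]

variable {n : Type*} [Fintype n] [DecidableEq n] [Nonempty n]

/-- **THE SIGNED SUM AROUND A LOOP OF (0.4) PLUS THE AXIAL SUM IS THE THREE-SEGMENT SUM**: `Y(Γ ∪ [x,x′] ∪ (−Γ′) ∪ (−c)) + Y(c) = Y(Γ^σ) + Y([x,x′]) − Y(Γ^{σ′})`
(the tree's covariant split `covWalkSum_loop_eq` read at the flat background, `covWalkSum_one`, `holAt_one`). [cite: Balaban1985Averaging, (124)-(125) p.36] -/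
theorem walkSum_loop_add_axial (Y : PBond P j → Matrix n n ℂ) (c : PBond P (j + 1)) (i : Idx P) :
    walkSum Y (walk (emb c.src) (loopWord P.L c.dir (off i.1) i.2.1 i.2.2)) + walkSum Y (walk (emb c.src) (List.replicate P.L (c.dir, true))) =
      walkSum Y (walk (emb c.src) (stairWord i.2.1 (off i.1))) +
        walkSum Y (walk (walkEnd (emb c.src) (stairWord i.2.1 (off i.1))) (List.replicate P.L (c.dir, true))) -
        walkSum Y (walk (emb c.tgt) (stairWord i.2.2 (off i.1))) := by
  have h := covWalkSum_loop_eq (1 : GaugeField P j (Matrix.specialUnitaryGroup n ℂ)) Y c i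
  simp only [covWalkSum_one, holAt_one, loopHol, mul_one, inv_one, OneMemClass.coe_one, star_one, one_mul, sub_self, add_zero] at h
  exact h

/-- **THE MEAN OF THE LOOP SUMS PLUS THE AXIAL SUM IS THE LINEARISED (0.4) AVERAGE `(Q₁Y)(c)`** (`BlockAveragingEMLLinearised.linAvg`).
[cite: Balaban1985Averaging, (124)-(125) p.36] -/
theorem mean_walkSum_loop_add_axial_eq_linAvg (Y : PBond P j → Matrix n n ℂ) (c : PBond P (j + 1)) :
    ((Fintype.card (Idx P) : ℂ))⁻¹ • ∑ i : Idx P, walkSum Y (walk (emb c.src) (loopWord P.L c.dir (off i.1) i.2.1 i.2.2)) +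
        walkSum Y (walk (emb c.src) (List.replicate P.L (c.dir, true))) = linAvg Y c := by
  have hc : (Fintype.card (Idx P) : ℂ) ≠ 0 := Nat.cast_ne_zero.mpr Fintype.card_ne_zero
  set A : Matrix n n ℂ := walkSum Y (walk (emb c.src) (List.replicate P.L (c.dir, true))) with hA
  have hterm : ∀ i : Idx P, walkSum Y (walk (emb c.src) (loopWord P.L c.dir (off i.1) i.2.1 i.2.2)) =
      (walkSum Y (walk (emb c.src) (stairWord i.2.1 (off i.1))) +
        walkSum Y (walk (walkEnd (emb c.src) (stairWord i.2.1 (off i.1))) (List.replicate P.L (c.dir, true))) -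
        walkSum Y (walk (emb c.tgt) (stairWord i.2.2 (off i.1)))) - A := fun i => by
    rw [← walkSum_loop_add_axial Y c i, hA, add_sub_cancel_right]
  rw [linAvg_def]
  simp only [hterm, Finset.sum_sub_distrib, Finset.sum_const, Finset.card_univ, smul_sub]
  rw [← Nat.cast_smul_eq_nsmul ℂ, smul_smul, inv_mul_cancel₀ hc, one_smul, sub_add_cancel]

/-! ## §2 The second-order expansion with `Q₁` as its main term -/

/-- **★★ `log Ū(c) = (Q₁Y)(c) + B₂(Y)(c) + O((ℓδ)³)`** for an exponential field `U_b = e^{Y_b}` (`Y_b* = −Y_b`, `‖Y_b‖ ≤ δ`, `100ℓδ ≤ 1`, `2ℓδ < δ_N`), with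
`B₂(Y)(c) = ½(|I|⁻¹Σᵢ pairBr(±Y along Γᵢ) + pairBr(±Y along Λ) + [(Q₁Y)(c), Y(Λ)])` — `…EMLSecondOrder.norm_mlog_avgFun_sub_second_order_le` with its first bracket
identified as `Q₁Y = linAvg Y` (§1) and `[Q₁Y − Y(Λ), Y(Λ)] = [Q₁Y, Y(Λ)]`. [cite: Balaban1985Averaging, Prop. 3 (121)-(125) p.36; Balaban1987RG1, (0.4) p.253] -/
theorem norm_mlog_avgFun_sub_linAvg_sub_second_order_le (U : GaugeField P j (Matrix.specialUnitaryGroup n ℂ)) (Y : PBond P j → Matrix n n ℂ)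
    (hUY : ∀ b, ((U b : Matrix.specialUnitaryGroup n ℂ) : Matrix n n ℂ) = exp (Y b)) (hY : ∀ b, star (Y b) = -Y b)
    {δ : ℝ} (hδ : 0 ≤ δ) (hYδ : ∀ b, ‖Y b‖ ≤ δ)
    (h100 : 100 * ((((P.d + 2) * P.L : ℕ) : ℝ) * δ) ≤ 1) (hN : 2 * ((((P.d + 2) * P.L : ℕ) : ℝ) * δ) < deltaSU n)
    (c : PBond P (j + 1)) :
    ‖mlog ((avgFun (expMeanLogSU (n := n)) U c : Matrix.specialUnitaryGroup n ℂ) : Matrix n n ℂ) -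
        (linAvg Y c +
          (2 : ℂ)⁻¹ • ((((Fintype.card (Idx P) : ℂ))⁻¹ • ∑ i : Idx P,
                pairBr ((walk (emb c.src) (loopWord P.L c.dir (off i.1) i.2.1 i.2.2)).map fun s => if s.fwd then Y s.bond else -Y s.bond)) +
              pairBr ((walk (emb c.src) (List.replicate P.L (c.dir, true))).map fun s => if s.fwd then Y s.bond else -Y s.bond) +
              ⁅linAvg Y c, walkSum Y (walk (emb c.src) (List.replicate P.L (c.dir, true)))⁆))‖ ≤
      300000 * ((((P.d + 2) * P.L : ℕ) : ℝ) * δ) ^ 3 := by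
  have h := norm_mlog_avgFun_sub_second_order_le U Y hUY hY hδ hYδ h100 hN c
  have hmain := mean_walkSum_loop_add_axial_eq_linAvg Y c
  -- the commutator: `[Q₁Y − Y(Λ), Y(Λ)] = [Q₁Y, Y(Λ)]`
  have hcomm : ⁅((Fintype.card (Idx P) : ℂ))⁻¹ • ∑ i : Idx P, walkSum Y (walk (emb c.src) (loopWord P.L c.dir (off i.1) i.2.1 i.2.2)),
        walkSum Y (walk (emb c.src) (List.replicate P.L (c.dir, true)))⁆ =
      ⁅linAvg Y c, walkSum Y (walk (emb c.src) (List.replicate P.L (c.dir, true)))⁆ := by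
    rw [← hmain]
    simp only [Ring.lie_def, add_mul, mul_add]
    abel
  rw [hcomm, hmain] at h
  exact h

end Summit.QuantumFields.YangMills.Theorems.EMLSecondOrder

end
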